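import Literature.NumberTheory.Automorphic.ShimuraCurveRibetTakahashiComponentOrders
import Literature.NumberTheory.Automorphic.ShimuraCurveRibetTakahashiBrandtDictionaryProofs
import HarnessLib

/-!
# The component-orders fact `PastenShimura2024_componentOrders` in Ribet–Takahashi's coordinates:
# reduction to four printed theorems over the tree's Brandt modules

Topic `NumberTheory/Automorphic`; a proofs-only companion (theorems only: no definition, no named
fact, nothing restated; D-0026) of `ShimuraCurveRibetTakahashiComponentOrders.lean`, whose ONE named
fact `PastenShimura2024_componentOrders` (H. Pasten, *Shimura curves and the abc conjecture*,
J. Number Theory 254 (2024) 214–335 = arXiv:1705.09251, §6.4, §6.6, Prop. 6.13, Lemma 6.14 (proof),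
Lemma 6.18) asserts the existence of the Skolem functions `cI = i_p(D,M)`, `cJ = j_p(D,M)` (orders of
the image and of the cokernel of `q_{D,M,p,*} : Φ_p(J₀^D(M)) → Φ_p(A_{D,M})` on Néron component
groups) with their four printed properties (Π) `i_p j_p = c_p(A_{D,M})`, (6.13) Ribet–Takahashi's
degree comparison, (6.14) Ribet's Eisenstein divisibility of the image, (6.18) Papikian–Rabinoff's
bound on the cokernel. The tree has no Néron model of a Jacobian, so the fact is not dischargeable as
such; but it has the COORDINATES in which Ribet–Takahashi and Takahashi compute these numbers — the
Brandt setups `Brandt.XiSetup N⁺ N⁻` (a definite quaternion algebra of discriminant `N⁻` with an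
Eichler order of level `N⁺`) and the self-pairing `S.xi λ = Σ_c w_c g_c²` of the `λ`-eigen-line of
their Brandt matrices (`BrandtXi.lean`; existence for admissible types and setup-independence PROVED:
`Brandt.nonempty_xiSetup_iff_admissible`, `Brandt.XiSetup.xi_eq_xi`) — and, in them, the whole of
Pasten's Thm. 6.1 (b) has already been reduced to printed theorems
(`ShimuraCurveRibetTakahashiBrandtCoordinatesProofs.lean`, `…BrandtDictionaryProofs.lean`).

**This file runs that reduction for the component-orders fact itself.** The printed architecture
(S. Takahashi, J. Number Theory 90 (2001) 74–88, held text read pp. 77–85; Pasten pp. 22–25;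
M. Papikian, J. Rabinoff, Canad. J. Math. 68 (2016) = arXiv:1212.3574, §3, held text read):

* Takahashi §2 pp. 78–80 (ANY admissible `(D, M)`, `π : J₀^D(M) → E` optimal of degree
  `δ = δ_D(M)`, any prime `r ∣ N`; p. 80: "The results stated so far are true for any prime `r`
  dividing `N`"): `c_r = #Φ_r(E)`, `i_r = #image(π_*)`, `j_r = #coker(π_*)`, p. 79 "`j_r = c_r / i_r`",
  **Thm. 2.3** "`i_r` divides `h_r`, and `δ = (h_r/i_r) · j_r`", `h_r` the monodromy self-pairing of a
  generator of the `f`-eigen-line of the character group `X_r(J)`;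
* the dictionary `h_r = ξ`: on the level side (`p ∥ M`, `M = p m`) `X_p(J₀^D(pm)) ≅ ℤ[Cls O]⁰` for the
  Eichler order of level `m` in the definite quaternion algebra of discriminant `Dp`, Hecke- and
  pairing-compatibly (p. 84, proof of Thm. 3.8, Buzzard 1997 Thm. 4.7; `D = 1`: Ribet 1990 §3) —
  Brandt type `(m, Dp)`; on the discriminant side (`p ∣ D`) Prop. 3.1 p. 82 (Ribet's exact sequence,
  Čerednik–Drinfeld; = Ribet–Takahashi 1997 Prop. 1) with **Thm. 3.2 (a)** "`h_q = h'_p`" — Brandt type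
  `(pM, D/p)`;
* so Prop. 6.13 (= Ribet–Takahashi 1997 Thm. 2) is two instances of Thm. 2.3 with the SAME
  `h = ξ` over a setup of type `(rM, dp)` (`δ₁ i₁ = ξ j₁`, `i₁ j₁ = c₁` for `X₀^d(prM)` at `p`;
  `δ₂ i₂ = ξ j₂`, `i₂ j₂ = c₂` for `X₀^{dpr}(M)` at `r`; whence `δ₁ i₁² j₂² = δ₂ c₁ c₂`), (Π) is
  `i j = c` on either side, and the system `{0 < i, i j = c_p, δ i = ξ j}` has exactly ONE solution
  (`δ i² = ξ c`), Takahashi's `(i_p, j_p)`;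
* Pasten p. 23 (proof of Lemma 6.14; Ribet, Sém. Théor. Nombres Bordeaux 1987–88 exp. 6;
  Ribet–Takahashi 1997 Prop. 3): `Φ_p(J₀^D(M))` is Eisenstein for `p ∥ M`, so
  `i_p(D,M) ∣ r + 1 − a_r(A_{D,M})`, `r ∤ N`;
* Pasten p. 24–25, Lemma 6.18, from Papikian–Rabinoff 2016 Cor. 3.5 (arXiv text §3: "(3.?)
  `coker(π_* : Φ_J → Φ_E) ≅ ℤ/cℤ` … Corollary. `#coker(π_*)` divides the order of the group of roots of
  unity in `K^×`", split toric case, reached after an unramified quadratic twist): for `p ∣ D`,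
  `j_p(D,M) ∣ p − 1` (`p` odd), `j_2(D,M) ∣ 2`.

## What is proved (sorry-free; no `def`, no named fact)

* §I `coupledChoice_spec_left/right`, `coupledChoice_pos` — the selection by choice of a PAIR
  `(i, j)`, coupled: the level system at `p ∣ M`, the discriminant system otherwise (the two Skolem
  functions of the fact must satisfy `cI · cJ = c_p` at EVERY `p ∥ N`, so the independent selections of
  `…BrandtCoordinatesProofs` §IV do not suffice).
* §II (section `Coordinates`, any functions `cI cJ` solving the level system at `p ∥ M` (`hlev`) and the
  discriminant system at `p ∣ D` (`hdisc`) in every setup): `productEq_of_coordinates` ((Π)),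
  `prop613_of_coordinates` (Prop. 6.13 for every `d`, by `prop_6_13_identity_of_thm_2_3`),
  `imageEisenstein_of_coordinates` (from `hEis`), `cokernelDvd_of_coordinates` (from `hPR`),
  `componentOrders_of_coordinates`.
* §III `componentOrders_of_selection` and **`PastenShimura2024_componentOrders_of_takahashi_coordinates`
  — the trust base after this file**: the named fact from FOUR PRINTED THEOREMS, each one self-contained
  statement over the tree's vocabulary with no undefined function in it — (`hTlev`) Takahashi 2001
  Thm. 2.3 for `X₀^D(M)` at `p ∥ M`, type `(M/p, Dp)`; (`hT2`) Thm. 2.3 with Thm. 3.2 (a) at `p ∣ D`,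
  type `(pM, D/p)`; (`hEis`) Ribet's Eisenstein divisibility in coordinates — these three VERBATIM the
  hypotheses of `PastenShimura2024_thm_6_1_b_of_takahashi_treeFacts` (so one vendoring serves the `abc`
  line and this one); and (`hPR`, NEW here) Papikian–Rabinoff's Cor. 3.5 = Pasten's Lemma 6.18 in the
  same coordinates: for every solution `(i, j)` of the discriminant system at `(P, p)`, `p ∣ D`,
  `j ∣ p − 1` (`p` odd), `j ∣ 2` (`p = 2`).
* §IV `PastenShimura2024_componentOrders_of_brandtDictionaries`: the same with `hTlev`, `hT2` derived
  from the character-group dictionaries `hDict`, `hDictDisc` of `…BrandtDictionaryProofs`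
  (`thm_2_3_level_of_brandtDictionary`, `thm_2_3_disc_of_brandtDictionary`), so that all of Takahashi's
  algebra (Lemma 2.2, Thm. 2.3 on both sides) and Ribet–Takahashi's Thm. 2 are theorems and the inputs
  are the two dictionaries, the exact Eisenstein property and Papikian–Rabinoff.

**Honesty.** Nothing here proves `PastenShimura2024_componentOrders` outright, let alone a statement of
`Summits/BirchSwinnertonDyer`: the consumer `PastenComponentOrdersInput` (stmt-BirchSwinnertonDyer-19716)
becomes conditional on the four printed inputs above AS TYPED, and nothing more. The exact Eisenstein
divisibility is NOT derivable from the naive Brandt-module argument (which yields `i ∣ 12(ℓ + 1 − a_ℓ)`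
only, `eisenstein12_of_brandtDictionary`); it and Papikian–Rabinoff are theorems about Néron models the
tree does not have.

## References

* [PastenShimura2024] H. Pasten, J. Number Theory 254 (2024) 214–335 = arXiv:1705.09251: §6.4 and
  Lemma 6.8 p. 22, §6.6, Prop. 6.13 and Lemma 6.14 (proof) p. 23, remark p. 24, Lemma 6.18 pp. 24–25,
  §6.9 p. 25 (held text, read).
* [Takahashi2001] S. Takahashi, J. Number Theory 90 (2001) 74–88: §2 pp. 77–80 (Lemma 2.1–2.2,
  Thm. 2.3, remark p. 80), §3.1 p. 82 (Prop. 3.1, Thm. 3.2 (a)), §3.2 p. 84 (proof of Thm. 3.8) (held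
  text, read).
* [PapikianRabinoff2016] M. Papikian, J. Rabinoff, *Optimal quotients of Jacobians with toric reduction
  and component groups*, Canad. J. Math. 68 (2016) 1362–1381 = arXiv:1212.3574, §3: display
  `coker(π_*) ≅ ℤ/cℤ` and Cor. 3.5 (held arXiv text, read; there §3 ¶26–27).
* [RibetTakahashi1997] K. A. Ribet, S. Takahashi, PNAS 94 (1997) 11110–11114, Prop. 1–3, Thm. 2 (cited
  through Pasten and Takahashi). [RibetComponentGroups1988] K. A. Ribet, Sém. Théor. Nombres Bordeaux
  1987–88, exp. 6. [Ribet1990] Invent. Math. 100, §3, Thm. 4.1. [Buzzard1997] Duke Math. J. 87,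
  Thm. 4.7. [VignerasLNM800] Ch. III §3 Thm. 3.1.

## Mathlib / tree search

Tree (reused): `prop_6_13_identity_of_thm_2_3`, `pos_of_thm_2_3`,
`IsAdmissibleFactorization.nonempty_xiSetup_level` / `…_disc`, `IsAdmissibleFactorization.erase_two_primes`,
`Brandt.XiSetup.brandtXi_eq_xi`, `LFunction_eq_of_isIsogenous_holds`, `thm_2_3_level_of_brandtDictionary`,
`thm_2_3_disc_of_brandtDictionary`. Mathlib: `Classical.choose_spec`, `Nat.mul_div_cancel_left`. No
Néron model / component group of a Jacobian exists in Mathlib or the tree; none is needed here.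
-/

noncomputable section

open scoped MatrixGroups ModularForm BigOperators

namespace Literature.NumberTheory.Automorphic

open Literature.NumberTheory.EllipticCurves (LFunction_eq_of_isIsogenous_holds)

/-! ## I. The coupled selection by choice of a pair `(i, j)` -/

/-- The coupled selection satisfies the first system when the switch is on and that system is
solvable. [folklore] -/
private theorem coupledChoice_spec_left (b : Prop) [Decidable b] (Q₁ Q₂ : ℕ × ℕ → Prop)
    [Decidable (∃ ij, Q₁ ij)] [Decidable (∃ ij, Q₂ ij)] (hb : b) (hex : ∃ ij, Q₁ ij) :
    Q₁ (if b then (if h : ∃ ij, Q₁ ij then Classical.choose h else (1, 1))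
      else (if h : ∃ ij, Q₂ ij then Classical.choose h else (1, 1))) := by
  rw [if_pos hb, dif_pos hex]; exact Classical.choose_spec hex

/-- The coupled selection satisfies the second system when the switch is off and that system is
solvable. [folklore] -/
private theorem coupledChoice_spec_right (b : Prop) [Decidable b] (Q₁ Q₂ : ℕ × ℕ → Prop)
    [Decidable (∃ ij, Q₁ ij)] [Decidable (∃ ij, Q₂ ij)] (hb : ¬ b) (hex : ∃ ij, Q₂ ij) :
    Q₂ (if b then (if h : ∃ ij, Q₁ ij then Classical.choose h else (1, 1))
      else (if h : ∃ ij, Q₂ ij then Classical.choose h else (1, 1))) := by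
  rw [if_neg hb, dif_pos hex]; exact Classical.choose_spec hex

/-- Both coordinates of the coupled selection are positive (junk value `(1, 1)`), provided the two
systems only have positive solutions. [folklore] -/
private theorem coupledChoice_pos (b : Prop) [Decidable b] (Q₁ Q₂ : ℕ × ℕ → Prop)
    [Decidable (∃ ij, Q₁ ij)] [Decidable (∃ ij, Q₂ ij)]
    (h₁ : ∀ ij, Q₁ ij → 0 < ij.1 ∧ 0 < ij.2) (h₂ : ∀ ij, Q₂ ij → 0 < ij.1 ∧ 0 < ij.2) :
    0 < (if b then (if h : ∃ ij, Q₁ ij then Classical.choose h else (1, 1))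
      else (if h : ∃ ij, Q₂ ij then Classical.choose h else (1, 1))).1 ∧
    0 < (if b then (if h : ∃ ij, Q₁ ij then Classical.choose h else (1, 1))
      else (if h : ∃ ij, Q₂ ij then Classical.choose h else (1, 1))).2 := by
  by_cases hb : b
  · rw [if_pos hb]
    by_cases h : ∃ ij, Q₁ ij
    · rw [dif_pos h]; exact h₁ _ (Classical.choose_spec h)
    · rw [dif_neg h]; exact ⟨one_pos, one_pos⟩
  · rw [if_neg hb]
    by_cases h : ∃ ij, Q₂ ij
    · rw [dif_pos h]; exact h₂ _ (Classical.choose_spec h)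
    · rw [dif_neg h]; exact ⟨one_pos, one_pos⟩

/-! ## II. The four printed properties from the coordinates -/

section Coordinates

variable
  /- (`hEis`) **Ribet's Eisenstein property of `Φ_p(J₀^D(M))`, `p ∥ M`, as used in Pasten's proof of
  Lemma 6.14** (p. 23: "`T_r` acts on it as multiplication by `r + 1` … It follows that
  `i_p(J₀^D(M), χ_{D,M})` divides `r + 1 − a_r(A_{D,M})` for every prime `r ∤ N`"; Ribet, Sém. Théor.
  Nombres Bordeaux 1987–88 exp. 6; Ribet–Takahashi 1997, proof of Prop. 3), in coordinates: for
  `N = DM` admissible, `M = p m`, `p ∤ m`, `P` minimal for a curve `W` of conductor `N` on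
  `X₀^D(M)` (curve `W' ≅ A_{D,M}`), every setup `S` of type `(m, Dp)`, every solution `(i, j)` of
  `i j = ord_p Δ_min(W')`, `δ_{D,M} i = S.xi (a(W')) j` (i.e. for `(i_p, j_p)`) and every prime `ℓ ∤ N`:
  `i ∣ ℓ + 1 − a_ℓ(W')`. VERBATIM the `hEis` of
  `PastenShimura2024_thm_6_1_b_of_takahashi_treeFacts` (`…BrandtCoordinatesProofs.lean`). -/
  (hEis : ∀ {N D M p m : ℕ}, p.Prime → M = p * m → ¬ p ∣ m → IsAdmissibleFactorization N D M →
    ∀ (X : ShimuraCurveData D M) (W : WeierstrassCurve ℚ) [W.IsElliptic], W.conductorNorm ℤ = N →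
    ∀ (W' : WeierstrassCurve ℚ) [W'.IsElliptic] (P : ShimuraParametrizationData X W'),
      P.IsMinimalFor W →
    ∀ (S : Brandt.XiSetup m (D * p)) (i j : ℕ), 0 < i →
      i * j = (W'.minimalDiscriminantNorm ℤ).factorization p →
      P.deg * i = S.xi (fun n => W'.LFunction n) * j →
      ∀ ℓ : ℕ, ℓ.Prime → ¬ ℓ ∣ N → (i : ℤ) ∣ (ℓ + 1 : ℤ) - W'.LFunction ℓ)
  /- (`hPR`) **Papikian–Rabinoff 2016, Cor. 3.5 (= Pasten 2024, Lemma 6.18), in coordinates.**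
  Printed: Pasten p. 24–25, "Lemma 6.18. Let `E` be an elliptic curve over `ℚ` of conductor `N` and
  consider an admissible factorization `N = DM`. Let `p` be a prime with `p ∣ D`. Then `j_p(D,M)`
  divides `p − 1` if `p` is odd, and it divides `2` if `p = 2`. … Proof. … After an unramified
  quadratic twist … we reduce to the split toric reduction case, and then the result follows from
  Corollary 3.5 in [PaRa]"; Papikian–Rabinoff §3: "`coker(π_* : Φ_J → Φ_E) ≅ ℤ/cℤ`" and
  "Corollary. `#coker(π_*)` divides the order of the group of roots of unity in `K^×`" (for an optimal
  elliptic quotient `π : J → E` of a Jacobian with split toric reduction over the local field `K`;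
  `#μ(ℚ_p) = p − 1` for `p` odd, `2` for `p = 2`). In the coordinates of `hT2` (`…BrandtCoordinatesProofs`):
  for `N = DM` admissible, `D = p d`, `P` minimal for a curve `W` of conductor `N` on `X₀^D(M)`,
  every setup `S` of type `(pM, d)` and every solution `(i, j)` of `i j = ord_p Δ_min(W')`,
  `δ_{D,M} i = S.xi (a(W')) j` — i.e. for Takahashi's `(i_p, j_p) = (#image, #coker)` of `q_{D,M,p,*}`,
  the unique solution (Thm. 2.3 with Thm. 3.2 (a), Lemma 2.1–2.2; `δ i² = ξ c`) —:
  `p ≠ 2 → j ∣ p − 1` and `p = 2 → j ∣ 2`. -/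
  (hPR : ∀ {N D M p d : ℕ}, p.Prime → D = p * d → IsAdmissibleFactorization N D M →
    ∀ (X : ShimuraCurveData D M) (W : WeierstrassCurve ℚ) [W.IsElliptic], W.conductorNorm ℤ = N →
    ∀ (W' : WeierstrassCurve ℚ) [W'.IsElliptic] (P : ShimuraParametrizationData X W'),
      P.IsMinimalFor W →
    ∀ (S : Brandt.XiSetup (p * M) d) (i j : ℕ), 0 < i →
      i * j = (W'.minimalDiscriminantNorm ℤ).factorization p →
      P.deg * i = S.xi (fun n => W'.LFunction n) * j →
      (p ≠ 2 → j ∣ p - 1) ∧ (p = 2 → j ∣ 2))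
  /- The coordinates: two functions of Shimura data and primes (`i_p(D,M) = cI P p`,
  `j_p(D,M) = cJ P p`) … -/
  (cI cJ : ComponentOrderFun)
  /- … solving TOGETHER the level system at `(P, p)` for `p ∥ M`, in every setup of type `(M/p, Dp)` … -/
  (hlev : ∀ {N D M p m : ℕ}, p.Prime → M = p * m → ¬ p ∣ m → IsAdmissibleFactorization N D M →
    ∀ (X : ShimuraCurveData D M) (W : WeierstrassCurve ℚ) [W.IsElliptic], W.conductorNorm ℤ = N →
    ∀ (W' : WeierstrassCurve ℚ) [W'.IsElliptic] (P : ShimuraParametrizationData X W'),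
      P.IsMinimalFor W →
    ∀ S : Brandt.XiSetup m (D * p),
      0 < cI P p ∧ cI P p * cJ P p = (W'.minimalDiscriminantNorm ℤ).factorization p ∧
        P.deg * cI P p = S.xi (fun n => W'.LFunction n) * cJ P p)
  /- … and the discriminant system at `(P, p)` for `p ∣ D`, in every setup of type `(pM, D/p)`. -/
  (hdisc : ∀ {N D M p d : ℕ}, p.Prime → D = p * d → IsAdmissibleFactorization N D M →
    ∀ (X : ShimuraCurveData D M) (W : WeierstrassCurve ℚ) [W.IsElliptic], W.conductorNorm ℤ = N →
    ∀ (W' : WeierstrassCurve ℚ) [W'.IsElliptic] (P : ShimuraParametrizationData X W'),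
      P.IsMinimalFor W →
    ∀ S : Brandt.XiSetup (p * M) d,
      0 < cI P p ∧ cI P p * cJ P p = (W'.minimalDiscriminantNorm ℤ).factorization p ∧
        P.deg * cI P p = S.xi (fun n => W'.LFunction n) * cJ P p)

include hlev hdisc in
/-- **(Π) `i_p(D,M) · j_p(D,M) = #Φ_p(A_{D,M}) = c_p(A_{D,M})` at every `p ∥ N`** (Pasten §6.6 with
§6.4: "`Φ_p(A)` is a cyclic group of order `c_p(A) := v_p(Δ_A)`"; Takahashi p. 79: "`j_r = c_r / i_r`")
— the predicate `ComponentOrders.ProductEq` — from the coordinates: a prime `p ∥ N = DM` divides `D`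
(discriminant system, a setup of type `(pM, D/p)` exists) or divides `M` exactly (level system, type
`(M/p, Dp)`), and both systems contain `i j = c_p`.
[cite: PastenShimura2024, §6.6 p. 23 and §6.4 p. 22] [cite: Takahashi2001, Thm. 2.3 (p. 79)] -/
theorem productEq_of_coordinates : ComponentOrders.ProductEq cI cJ := by
  intro N D M hadm X W _ _ hWN W' _ P hP p hp hpN hp2N
  have hDM : D * M = N := hadm.mul_eq
  rcases (Nat.Prime.dvd_mul hp).mp (hDM ▸ hpN : p ∣ D * M) with hpD | hpM
  · obtain ⟨d, hD⟩ := hpD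
    obtain ⟨S⟩ := hadm.nonempty_xiSetup_disc hp hD
    exact (hdisc hp hD hadm X W hWN W' P hP S).2.1
  · obtain ⟨m, hM⟩ := hpM
    have hpm : ¬ p ∣ m := fun ⟨k, hk⟩ => hp2N ⟨D * k, by rw [← hDM, hM, hk]; ring⟩
    obtain ⟨S⟩ := hadm.nonempty_xiSetup_level hp hM hpm
    exact (hlev hp hM hpm hadm X W hWN W' P hP S).2.1

include hlev hdisc in
/-- **Pasten 2024, Prop. 6.13 (= Ribet–Takahashi 1997, Thm. 2), first line, for EVERY `d`** — the
predicate `ComponentOrders.Prop613` — from the coordinates: for `N = DM` admissible, `D = d · pr`,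
`M₁ = prM`, `N = d · M₁` is admissible with `p ∥ M₁` (`erase_two_primes`); ONE setup `S` of type
`(rM, dp)` serves the level system of `X₀^d(M₁)` at `p` and the discriminant system of `X₀^D(M)` at
`r`; `a(W₁') = a(W) = a(W₂')` (isogeny invariance); then `prop_6_13_identity_of_thm_2_3`
(`δ₁ i₁² j₂² = δ₂ (i₁ j₁)(i₂ j₂)`). This is how Ribet–Takahashi prove their Thm. 2 from Props. 1–2.
[cite: PastenShimura2024, Prop. 6.13 p. 23] [cite: Takahashi2001, Thm. 2.3 (p. 79), Prop. 3.1 and Thm. 3.2 (a) (p. 82), p. 84] [cite: RibetTakahashi1997, Thm. 2] -/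
theorem prop613_of_coordinates : ComponentOrders.Prop613 cI cJ := by
  intro N d M₁ D M p r hp hr hpr hD hM₁ hadm X₁ X₂ W _ _ hWN W₁' _ P₁ hP₁ W₂' _ P₂ hP₂
  -- `N = d · (prM)` is admissible, `p ∥ prM`, `D = r · (dp)`
  have hprD : p * r ∣ D := hD ▸ Dvd.intro_left d rfl
  obtain ⟨-, hadm₁, -, -⟩ := hadm.erase_two_primes hp hr hpr
    ((Dvd.intro r rfl).trans hprD) ((Dvd.intro_left p rfl).trans hprD)
  have hd : D / (p * r) = d := by
    rw [hD]; exact Nat.mul_div_cancel _ (Nat.mul_pos hp.pos hr.pos)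
  rw [hd, ← hM₁] at hadm₁
  have hM₁' : M₁ = p * (r * M) := by rw [hM₁]; ring
  have hpM : ¬ p ∣ M := fun h => by
    have h1 : p ∣ Nat.gcd D M := Nat.dvd_gcd ((Dvd.intro r rfl).trans hprD) h
    rw [hadm.coprime] at h1
    exact hp.one_lt.ne' (Nat.dvd_one.mp h1)
  have hprM : ¬ p ∣ r * M := fun h =>
    ((Nat.Prime.dvd_mul hp).mp h).elim (fun h' => hpr ((Nat.prime_dvd_prime_iff_eq hp hr).mp h'))
      hpM
  have hD' : D = r * (d * p) := by rw [hD]; ring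
  -- a common Brandt setup of type `(rM, dp)`, and one eigenvalue system `a(W)`
  obtain ⟨S⟩ := hadm₁.nonempty_xiSetup_level hp hM₁' hprM
  have hL₁ : (fun n => W₁'.LFunction n) = fun n => W.LFunction n := by
    rw [LFunction_eq_of_isIsogenous_holds W W₁' hP₁.1]
  have hL₂ : (fun n => W₂'.LFunction n) = fun n => W.LFunction n := by
    rw [LFunction_eq_of_isIsogenous_holds W W₂' hP₂.1]
  -- the level system of `X₀^d(prM)` at `p` and the discriminant system of `X₀^D(M)` at `r`
  obtain ⟨-, hc₁, hδ₁⟩ := hlev hp hM₁' hprM hadm₁ X₁ W hWN W₁' P₁ hP₁ S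
  obtain ⟨-, hc₂, hδ₂⟩ := hdisc hr hD' hadm X₂ W hWN W₂' P₂ hP₂ S
  rw [hL₁] at hδ₁
  rw [hL₂] at hδ₂
  exact prop_6_13_identity_of_thm_2_3 hδ₁ hc₁ hδ₂ hc₂

include hEis hlev in
/-- **The Eisenstein divisibility `i_p(D,M) ∣ r + 1 − a_r(A_{D,M})` (`p ∥ M`, `r ∤ N` prime)** —
the predicate `ComponentOrders.ImageEisenstein` — from its coordinate form `hEis`: `(cI P p, cJ P p)`
solves the level system in a setup of type `(M/p, Dp)` (which exists), and `hEis` applies to every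
solution. [cite: PastenShimura2024, Lemma 6.14 p. 23 (proof)] [cite: RibetComponentGroups1988, exp. 6] -/
theorem imageEisenstein_of_coordinates : ComponentOrders.ImageEisenstein cI := by
  intro N D M hadm X W _ _ hWN W' _ P hP p hp hpM hp2 r hr hrN
  obtain ⟨m, hM⟩ := hpM
  have hpm : ¬ p ∣ m := fun h => hp2 (by rw [hM, sq]; exact Nat.mul_dvd_mul_left p h)
  obtain ⟨S⟩ := hadm.nonempty_xiSetup_level hp hM hpm
  obtain ⟨hI, hc, hδ⟩ := hlev hp hM hpm hadm X W hWN W' P hP S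
  exact hEis hp hM hpm hadm X W hWN W' P hP S (cI P p) (cJ P p) hI hc hδ r hr hrN

include hPR hdisc in
/-- **Pasten 2024, Lemma 6.18 (Papikian–Rabinoff): `j_p(D,M) ∣ p − 1` for odd `p ∣ D`,
`j_2(D,M) ∣ 2`** — the predicate `ComponentOrders.CokernelDvd` — from its coordinate form `hPR`:
`(cI P p, cJ P p)` solves the discriminant system in a setup of type `(pM, D/p)` (which exists), and
`hPR` applies to every solution. [cite: PastenShimura2024, Lemma 6.18 pp. 24–25] [cite: PapikianRabinoff2016, Cor. 3.5] -/
theorem cokernelDvd_of_coordinates : ComponentOrders.CokernelDvd cJ := by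
  intro N D M hadm X W _ _ hWN W' _ P hP p hp hpD
  obtain ⟨d, hD⟩ := hpD
  obtain ⟨S⟩ := hadm.nonempty_xiSetup_disc hp hD
  obtain ⟨hI, hc, hδ⟩ := hdisc hp hD hadm X W hWN W' P hP S
  exact hPR hp hD hadm X W hWN W' P hP S (cI P p) (cJ P p) hI hc hδ

include hEis hPR hlev hdisc in
/-- **The component-orders fact from the coordinates** (any positive `cI`, `cJ` solving the two
systems where they are posed): the four predicates of `PastenShimura2024_componentOrders` are §II.
[cite: PastenShimura2024, §6.6 and Prop. 6.13 p. 23, Lemma 6.14 (proof) p. 23, Lemma 6.18 pp. 24–25] -/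
theorem componentOrders_of_coordinates
    (hpos : ∀ {D M : ℕ} {X : ShimuraCurveData D M} {W' : WeierstrassCurve ℚ}
      (P : ShimuraParametrizationData X W') (p : ℕ), 0 < cI P p ∧ 0 < cJ P p) :
    PastenShimura2024_componentOrders :=
  ⟨cI, cJ, hpos, productEq_of_coordinates cI cJ hlev hdisc, prop613_of_coordinates cI cJ hlev hdisc,
    imageEisenstein_of_coordinates hEis cI cJ hlev, cokernelDvd_of_coordinates hPR cI cJ hdisc⟩

end Coordinates

/-! ## III. The fact over four printed theorems -/

open scoped Classical in
/-- **The coupled selection solves the level system at `p ∥ M`.** If `sel P p` is, at `p ∣ M`, a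
solution `(i, j)` of the level system `{0 < i, 0 < j, i j = ord_p Δ_min(W'), P.deg · i =
brandtXi (M/p) (Dp) (a(W')) · j}` chosen by `Classical.choose` (junk `(1, 1)` if none), then under
Takahashi's Thm. 2.3 on the level side (`hTlev`: the system IS solvable for `P` minimal on `X₀^D(M)`,
`M = p m`, with `j ≥ 1` by `pos_of_thm_2_3`) the pair `sel P p` solves it in every setup `S` of type
`(m, Dp)` (`ξ` is setup-independent, `Brandt.XiSetup.brandtXi_eq_xi`) — i.e. `sel P p = (i_p, j_p)`.
[cite: Takahashi2001, Thm. 2.3 (p. 79), p. 84] -/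
theorem selection_level
    (hTlev : ∀ {N D M p m : ℕ}, p.Prime → M = p * m → ¬ p ∣ m → IsAdmissibleFactorization N D M →
      ∀ (X : ShimuraCurveData D M) (W : WeierstrassCurve ℚ) [W.IsElliptic], W.conductorNorm ℤ = N →
      ∀ (W' : WeierstrassCurve ℚ) [W'.IsElliptic] (P : ShimuraParametrizationData X W'),
        P.IsMinimalFor W →
      ∀ S : Brandt.XiSetup m (D * p),
        ∃ i j : ℕ, 0 < i ∧ i * j = (W'.minimalDiscriminantNorm ℤ).factorization p ∧
          i ∣ S.xi (fun n => W'.LFunction n) ∧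
          P.deg * i = S.xi (fun n => W'.LFunction n) * j)
    (sel : ∀ {D M : ℕ} {X : ShimuraCurveData D M} {W' : WeierstrassCurve ℚ},
      ShimuraParametrizationData X W' → ℕ → ℕ × ℕ)
    (hsel : ∀ {D M : ℕ} {X : ShimuraCurveData D M} {W' : WeierstrassCurve ℚ}
      (P : ShimuraParametrizationData X W') (p : ℕ),
      sel P p =
        if p ∣ M then
          (if h : ∃ ij : ℕ × ℕ, 0 < ij.1 ∧ 0 < ij.2 ∧
              ij.1 * ij.2 = (W'.minimalDiscriminantNorm ℤ).factorization p ∧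
              P.deg * ij.1 = brandtXi (M / p) (D * p) (fun n => W'.LFunction n) * ij.2
            then Classical.choose h else (1, 1))
        else
          (if h : ∃ ij : ℕ × ℕ, 0 < ij.1 ∧ 0 < ij.2 ∧
              ij.1 * ij.2 = (W'.minimalDiscriminantNorm ℤ).factorization p ∧
              P.deg * ij.1 = brandtXi (p * M) (D / p) (fun n => W'.LFunction n) * ij.2
            then Classical.choose h else (1, 1))) :
    ∀ {N D M p m : ℕ}, p.Prime → M = p * m → ¬ p ∣ m → IsAdmissibleFactorization N D M →
      ∀ (X : ShimuraCurveData D M) (W : WeierstrassCurve ℚ) [W.IsElliptic], W.conductorNorm ℤ = N →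
      ∀ (W' : WeierstrassCurve ℚ) [W'.IsElliptic] (P : ShimuraParametrizationData X W'),
        P.IsMinimalFor W →
      ∀ S : Brandt.XiSetup m (D * p),
        0 < (sel P p).1 ∧ (sel P p).1 * (sel P p).2 = (W'.minimalDiscriminantNorm ℤ).factorization p ∧
          P.deg * (sel P p).1 = S.xi (fun n => W'.LFunction n) * (sel P p).2 := by
  classical
  intro N D M p m hp hM hpm hadm X W _ hWN W' _ P hP S
  obtain ⟨i, j, hi, hc, -, hδ⟩ := hTlev hp hM hpm hadm X W hWN W' P hP S
  have hj : 0 < j := (pos_of_thm_2_3 P.deg_pos hi hδ).1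
  have hdiv : M / p = m := by rw [hM]; exact Nat.mul_div_cancel_left _ hp.pos
  have hpM : p ∣ M := ⟨m, hM⟩
  have hex : ∃ ij : ℕ × ℕ, 0 < ij.1 ∧ 0 < ij.2 ∧
      ij.1 * ij.2 = (W'.minimalDiscriminantNorm ℤ).factorization p ∧
      P.deg * ij.1 = brandtXi (M / p) (D * p) (fun n => W'.LFunction n) * ij.2 :=
    ⟨(i, j), hi, hj, hc, by rw [hdiv, S.brandtXi_eq_xi]; exact hδ⟩
  have key := coupledChoice_spec_left (p ∣ M) _
    (fun ij : ℕ × ℕ => 0 < ij.1 ∧ 0 < ij.2 ∧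
      ij.1 * ij.2 = (W'.minimalDiscriminantNorm ℤ).factorization p ∧
      P.deg * ij.1 = brandtXi (p * M) (D / p) (fun n => W'.LFunction n) * ij.2) hpM hex
  rw [← hsel P p] at key
  obtain ⟨h1, -, h3, h4⟩ := key
  rw [hdiv, S.brandtXi_eq_xi] at h4
  exact ⟨h1, h3, h4⟩

open scoped Classical in
/-- **The coupled selection solves the discriminant system at `p ∣ D`.** Under Takahashi's Thm. 2.3
with Thm. 3.2 (a) on the discriminant side (`hT2`), for `P` minimal on `X₀^D(M)` and `D = p d` one has
`p ∤ M` (coprimality), so `sel P p` is the chosen solution of the discriminant system, and it solves it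
in every setup `S` of type `(pM, d)`. [cite: Takahashi2001, Thm. 2.3 (p. 79), Prop. 3.1 and Thm. 3.2 (a) (p. 82)] -/
theorem selection_disc
    (hT2 : ∀ {N D M p d : ℕ}, p.Prime → D = p * d → IsAdmissibleFactorization N D M →
      ∀ (X : ShimuraCurveData D M) (W : WeierstrassCurve ℚ) [W.IsElliptic],
        W.conductorNorm ℤ = N →
      ∀ (W' : WeierstrassCurve ℚ) [W'.IsElliptic] (P : ShimuraParametrizationData X W'),
        P.IsMinimalFor W →
      ∀ S : Brandt.XiSetup (p * M) d,
        ∃ i j : ℕ, 0 < i ∧ i * j = (W'.minimalDiscriminantNorm ℤ).factorization p ∧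
          i ∣ S.xi (fun n => W'.LFunction n) ∧
          P.deg * i = S.xi (fun n => W'.LFunction n) * j)
    (sel : ∀ {D M : ℕ} {X : ShimuraCurveData D M} {W' : WeierstrassCurve ℚ},
      ShimuraParametrizationData X W' → ℕ → ℕ × ℕ)
    (hsel : ∀ {D M : ℕ} {X : ShimuraCurveData D M} {W' : WeierstrassCurve ℚ}
      (P : ShimuraParametrizationData X W') (p : ℕ),
      sel P p =
        if p ∣ M then
          (if h : ∃ ij : ℕ × ℕ, 0 < ij.1 ∧ 0 < ij.2 ∧
              ij.1 * ij.2 = (W'.minimalDiscriminantNorm ℤ).factorization p ∧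
              P.deg * ij.1 = brandtXi (M / p) (D * p) (fun n => W'.LFunction n) * ij.2
            then Classical.choose h else (1, 1))
        else
          (if h : ∃ ij : ℕ × ℕ, 0 < ij.1 ∧ 0 < ij.2 ∧
              ij.1 * ij.2 = (W'.minimalDiscriminantNorm ℤ).factorization p ∧
              P.deg * ij.1 = brandtXi (p * M) (D / p) (fun n => W'.LFunction n) * ij.2
            then Classical.choose h else (1, 1))) :
    ∀ {N D M p d : ℕ}, p.Prime → D = p * d → IsAdmissibleFactorization N D M →
      ∀ (X : ShimuraCurveData D M) (W : WeierstrassCurve ℚ) [W.IsElliptic], W.conductorNorm ℤ = N →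
      ∀ (W' : WeierstrassCurve ℚ) [W'.IsElliptic] (P : ShimuraParametrizationData X W'),
        P.IsMinimalFor W →
      ∀ S : Brandt.XiSetup (p * M) d,
        0 < (sel P p).1 ∧ (sel P p).1 * (sel P p).2 = (W'.minimalDiscriminantNorm ℤ).factorization p ∧
          P.deg * (sel P p).1 = S.xi (fun n => W'.LFunction n) * (sel P p).2 := by
  classical
  intro N D M p d hp hD hadm X W _ hWN W' _ P hP S
  obtain ⟨i, j, hi, hc, -, hδ⟩ := hT2 hp hD hadm X W hWN W' P hP S
  have hj : 0 < j := (pos_of_thm_2_3 P.deg_pos hi hδ).1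
  have hdiv : D / p = d := by rw [hD]; exact Nat.mul_div_cancel_left _ hp.pos
  have hpM : ¬ p ∣ M := fun h => by
    have h1 : p ∣ Nat.gcd D M := Nat.dvd_gcd ⟨d, hD⟩ h
    rw [hadm.coprime] at h1
    exact hp.one_lt.ne' (Nat.dvd_one.mp h1)
  have hex : ∃ ij : ℕ × ℕ, 0 < ij.1 ∧ 0 < ij.2 ∧
      ij.1 * ij.2 = (W'.minimalDiscriminantNorm ℤ).factorization p ∧
      P.deg * ij.1 = brandtXi (p * M) (D / p) (fun n => W'.LFunction n) * ij.2 :=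
    ⟨(i, j), hi, hj, hc, by rw [hdiv, S.brandtXi_eq_xi]; exact hδ⟩
  have key := coupledChoice_spec_right (p ∣ M)
    (fun ij : ℕ × ℕ => 0 < ij.1 ∧ 0 < ij.2 ∧
      ij.1 * ij.2 = (W'.minimalDiscriminantNorm ℤ).factorization p ∧
      P.deg * ij.1 = brandtXi (M / p) (D * p) (fun n => W'.LFunction n) * ij.2) _ hpM hex
  rw [← hsel P p] at key
  obtain ⟨h1, -, h3, h4⟩ := key
  rw [hdiv, S.brandtXi_eq_xi] at h4
  exact ⟨h1, h3, h4⟩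

open scoped Classical in
/-- **Both coordinates of the coupled selection are positive everywhere** (junk value `(1, 1)` off the
solvable systems). [cite: PastenShimura2024, §6.6 p. 23 (i_p, j_p ≥ 1)] -/
theorem selection_pos
    (sel : ∀ {D M : ℕ} {X : ShimuraCurveData D M} {W' : WeierstrassCurve ℚ},
      ShimuraParametrizationData X W' → ℕ → ℕ × ℕ)
    (hsel : ∀ {D M : ℕ} {X : ShimuraCurveData D M} {W' : WeierstrassCurve ℚ}
      (P : ShimuraParametrizationData X W') (p : ℕ),
      sel P p =
        if p ∣ M then
          (if h : ∃ ij : ℕ × ℕ, 0 < ij.1 ∧ 0 < ij.2 ∧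
              ij.1 * ij.2 = (W'.minimalDiscriminantNorm ℤ).factorization p ∧
              P.deg * ij.1 = brandtXi (M / p) (D * p) (fun n => W'.LFunction n) * ij.2
            then Classical.choose h else (1, 1))
        else
          (if h : ∃ ij : ℕ × ℕ, 0 < ij.1 ∧ 0 < ij.2 ∧
              ij.1 * ij.2 = (W'.minimalDiscriminantNorm ℤ).factorization p ∧
              P.deg * ij.1 = brandtXi (p * M) (D / p) (fun n => W'.LFunction n) * ij.2
            then Classical.choose h else (1, 1))) :
    ∀ {D M : ℕ} {X : ShimuraCurveData D M} {W' : WeierstrassCurve ℚ}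
      (P : ShimuraParametrizationData X W') (p : ℕ), 0 < (sel P p).1 ∧ 0 < (sel P p).2 := by
  classical
  intro D M X W' P p
  have key := coupledChoice_pos (p ∣ M)
    (fun ij : ℕ × ℕ => 0 < ij.1 ∧ 0 < ij.2 ∧
      ij.1 * ij.2 = (W'.minimalDiscriminantNorm ℤ).factorization p ∧
      P.deg * ij.1 = brandtXi (M / p) (D * p) (fun n => W'.LFunction n) * ij.2)
    (fun ij : ℕ × ℕ => 0 < ij.1 ∧ 0 < ij.2 ∧
      ij.1 * ij.2 = (W'.minimalDiscriminantNorm ℤ).factorization p ∧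
      P.deg * ij.1 = brandtXi (p * M) (D / p) (fun n => W'.LFunction n) * ij.2)
    (fun ij h => ⟨h.1, h.2.1⟩) (fun ij h => ⟨h.1, h.2.1⟩)
  rw [← hsel P p] at key
  exact key

open scoped Classical in
/-- **The component-orders fact from Takahashi's Thm. 2.3 on both sides, Ribet's Eisenstein
divisibility and Papikian–Rabinoff, for a given coupled selection.** If `sel P p` is, at `p ∣ M`, a
solution `(i, j)` of the level system `{0 < i, 0 < j, i j = ord_p Δ_min(W'), P.deg · i =
brandtXi (M/p) (Dp) (a(W')) · j}` chosen by `Classical.choose` (junk `(1, 1)` if none), and otherwise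
the same for the discriminant system (`ξ = brandtXi (pM) (D/p) (a(W'))`), then `cI := (sel · ·).1`,
`cJ := (sel · ·).2` witness `PastenShimura2024_componentOrders`: by Thm. 2.3 (`hTlev`, `hT2`) the
systems are solvable where they are posed (`j ≥ 1` by `pos_of_thm_2_3`), at `p ∣ D` one has `p ∤ M`
(coprimality), the value of `ξ` does not depend on the setup (`Brandt.XiSetup.brandtXi_eq_xi`), and
§II applies. [cite: Takahashi2001, Thm. 2.3 (p. 79), Thm. 3.2 (a) (p. 82), p. 84] [cite: PastenShimura2024, §6.6, Prop. 6.13, Lemma 6.14 p. 23, Lemma 6.18 pp. 24–25] -/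
theorem componentOrders_of_selection
    (hTlev : ∀ {N D M p m : ℕ}, p.Prime → M = p * m → ¬ p ∣ m → IsAdmissibleFactorization N D M →
      ∀ (X : ShimuraCurveData D M) (W : WeierstrassCurve ℚ) [W.IsElliptic], W.conductorNorm ℤ = N →
      ∀ (W' : WeierstrassCurve ℚ) [W'.IsElliptic] (P : ShimuraParametrizationData X W'),
        P.IsMinimalFor W →
      ∀ S : Brandt.XiSetup m (D * p),
        ∃ i j : ℕ, 0 < i ∧ i * j = (W'.minimalDiscriminantNorm ℤ).factorization p ∧
          i ∣ S.xi (fun n => W'.LFunction n) ∧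
          P.deg * i = S.xi (fun n => W'.LFunction n) * j)
    (hT2 : ∀ {N D M p d : ℕ}, p.Prime → D = p * d → IsAdmissibleFactorization N D M →
      ∀ (X : ShimuraCurveData D M) (W : WeierstrassCurve ℚ) [W.IsElliptic],
        W.conductorNorm ℤ = N →
      ∀ (W' : WeierstrassCurve ℚ) [W'.IsElliptic] (P : ShimuraParametrizationData X W'),
        P.IsMinimalFor W →
      ∀ S : Brandt.XiSetup (p * M) d,
        ∃ i j : ℕ, 0 < i ∧ i * j = (W'.minimalDiscriminantNorm ℤ).factorization p ∧
          i ∣ S.xi (fun n => W'.LFunction n) ∧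
          P.deg * i = S.xi (fun n => W'.LFunction n) * j)
    (hEis : ∀ {N D M p m : ℕ}, p.Prime → M = p * m → ¬ p ∣ m → IsAdmissibleFactorization N D M →
      ∀ (X : ShimuraCurveData D M) (W : WeierstrassCurve ℚ) [W.IsElliptic], W.conductorNorm ℤ = N →
      ∀ (W' : WeierstrassCurve ℚ) [W'.IsElliptic] (P : ShimuraParametrizationData X W'),
        P.IsMinimalFor W →
      ∀ (S : Brandt.XiSetup m (D * p)) (i j : ℕ), 0 < i →
        i * j = (W'.minimalDiscriminantNorm ℤ).factorization p →
        P.deg * i = S.xi (fun n => W'.LFunction n) * j →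
        ∀ ℓ : ℕ, ℓ.Prime → ¬ ℓ ∣ N → (i : ℤ) ∣ (ℓ + 1 : ℤ) - W'.LFunction ℓ)
    (hPR : ∀ {N D M p d : ℕ}, p.Prime → D = p * d → IsAdmissibleFactorization N D M →
      ∀ (X : ShimuraCurveData D M) (W : WeierstrassCurve ℚ) [W.IsElliptic], W.conductorNorm ℤ = N →
      ∀ (W' : WeierstrassCurve ℚ) [W'.IsElliptic] (P : ShimuraParametrizationData X W'),
        P.IsMinimalFor W →
      ∀ (S : Brandt.XiSetup (p * M) d) (i j : ℕ), 0 < i →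
        i * j = (W'.minimalDiscriminantNorm ℤ).factorization p →
        P.deg * i = S.xi (fun n => W'.LFunction n) * j →
        (p ≠ 2 → j ∣ p - 1) ∧ (p = 2 → j ∣ 2))
    (sel : ∀ {D M : ℕ} {X : ShimuraCurveData D M} {W' : WeierstrassCurve ℚ},
      ShimuraParametrizationData X W' → ℕ → ℕ × ℕ)
    (hsel : ∀ {D M : ℕ} {X : ShimuraCurveData D M} {W' : WeierstrassCurve ℚ}
      (P : ShimuraParametrizationData X W') (p : ℕ),
      sel P p =
        if p ∣ M then
          (if h : ∃ ij : ℕ × ℕ, 0 < ij.1 ∧ 0 < ij.2 ∧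
              ij.1 * ij.2 = (W'.minimalDiscriminantNorm ℤ).factorization p ∧
              P.deg * ij.1 = brandtXi (M / p) (D * p) (fun n => W'.LFunction n) * ij.2
            then Classical.choose h else (1, 1))
        else
          (if h : ∃ ij : ℕ × ℕ, 0 < ij.1 ∧ 0 < ij.2 ∧
              ij.1 * ij.2 = (W'.minimalDiscriminantNorm ℤ).factorization p ∧
              P.deg * ij.1 = brandtXi (p * M) (D / p) (fun n => W'.LFunction n) * ij.2
            then Classical.choose h else (1, 1))) :
    PastenShimura2024_componentOrders :=
  componentOrders_of_coordinates hEis hPR (fun P p => (sel P p).1) (fun P p => (sel P p).2)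
    (selection_level hTlev sel hsel) (selection_disc hT2 sel hsel) (selection_pos sel hsel)

open scoped Classical in
/-- **`PastenShimura2024_componentOrders` over Ribet–Takahashi's printed theorems — the trust base
after this file.** The named fact (Pasten 2024 §6.6 with §6.4, Prop. 6.13, Lemma 6.14 (proof),
Lemma 6.18: the orders `i_p(D,M)`, `j_p(D,M)` of the image and cokernel of `q_{D,M,p,*}` on Néron
component groups, with (Π), (6.13), (6.14), (6.18)) from FOUR PRINTED THEOREMS, each a single
self-contained statement over the tree's Brandt-module vocabulary with no undefined function in it:
(`hTlev`) Takahashi 2001 Thm. 2.3 for `X₀^D(M)` at `p ∥ M`, Brandt type `(M/p, Dp)` (Takahashi p. 84 /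
Buzzard Thm. 4.7; its case `D = 1` in the classical idiom is the tree's fact
`Literature.NumberTheory.EllipticCurves.takahashi2001_thm_2_3_of_coprime`); (`hT2`) Thm. 2.3 with
Thm. 3.2 (a) at `p ∣ D`, type `(pM, D/p)` (Ribet's exact sequence, Prop. 3.1); (`hEis`) Ribet's
Eisenstein divisibility in coordinates — these three VERBATIM the hypotheses of
`PastenShimura2024_thm_6_1_b_of_takahashi_treeFacts`; (`hPR`) Papikian–Rabinoff 2016 Cor. 3.5 =
Pasten's Lemma 6.18 in the same coordinates. The Skolem functions `i_p`, `j_p` are the COUPLED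
selection by choice of the unique solution of Takahashi's system on the side where `p` lives (level
side at `p ∣ M`, discriminant side otherwise); (Π) for every `p ∥ N`, Prop. 6.13 for every `d`
(Ribet–Takahashi's Thm. 2 from their Props. 1–2), and the transport of (6.14)/(6.18) to the selected
orders are theorems (§II–III). No statement of `Summits/BirchSwinnertonDyer` is proved by this; the
consumer `PastenComponentOrdersInput` is exactly as conditional as these four inputs.
[cite: PastenShimura2024, §6.4 p. 22, §6.6 and Prop. 6.13 p. 23, Lemma 6.14 (proof) p. 23, Lemma 6.18 pp. 24–25]
[cite: Takahashi2001, Thm. 2.3 (p. 79), remark p. 80, Prop. 3.1 and Thm. 3.2 (a) (p. 82), p. 84]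
[cite: RibetTakahashi1997, Prop. 1–3, Thm. 2] [cite: PapikianRabinoff2016, Cor. 3.5]
[cite: RibetComponentGroups1988, exp. 6] -/
theorem PastenShimura2024_componentOrders_of_takahashi_coordinates
    (hTlev : ∀ {N D M p m : ℕ}, p.Prime → M = p * m → ¬ p ∣ m → IsAdmissibleFactorization N D M →
      ∀ (X : ShimuraCurveData D M) (W : WeierstrassCurve ℚ) [W.IsElliptic], W.conductorNorm ℤ = N →
      ∀ (W' : WeierstrassCurve ℚ) [W'.IsElliptic] (P : ShimuraParametrizationData X W'),
        P.IsMinimalFor W →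
      ∀ S : Brandt.XiSetup m (D * p),
        ∃ i j : ℕ, 0 < i ∧ i * j = (W'.minimalDiscriminantNorm ℤ).factorization p ∧
          i ∣ S.xi (fun n => W'.LFunction n) ∧
          P.deg * i = S.xi (fun n => W'.LFunction n) * j)
    (hT2 : ∀ {N D M p d : ℕ}, p.Prime → D = p * d → IsAdmissibleFactorization N D M →
      ∀ (X : ShimuraCurveData D M) (W : WeierstrassCurve ℚ) [W.IsElliptic],
        W.conductorNorm ℤ = N →
      ∀ (W' : WeierstrassCurve ℚ) [W'.IsElliptic] (P : ShimuraParametrizationData X W'),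
        P.IsMinimalFor W →
      ∀ S : Brandt.XiSetup (p * M) d,
        ∃ i j : ℕ, 0 < i ∧ i * j = (W'.minimalDiscriminantNorm ℤ).factorization p ∧
          i ∣ S.xi (fun n => W'.LFunction n) ∧
          P.deg * i = S.xi (fun n => W'.LFunction n) * j)
    (hEis : ∀ {N D M p m : ℕ}, p.Prime → M = p * m → ¬ p ∣ m → IsAdmissibleFactorization N D M →
      ∀ (X : ShimuraCurveData D M) (W : WeierstrassCurve ℚ) [W.IsElliptic], W.conductorNorm ℤ = N →
      ∀ (W' : WeierstrassCurve ℚ) [W'.IsElliptic] (P : ShimuraParametrizationData X W'),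
        P.IsMinimalFor W →
      ∀ (S : Brandt.XiSetup m (D * p)) (i j : ℕ), 0 < i →
        i * j = (W'.minimalDiscriminantNorm ℤ).factorization p →
        P.deg * i = S.xi (fun n => W'.LFunction n) * j →
        ∀ ℓ : ℕ, ℓ.Prime → ¬ ℓ ∣ N → (i : ℤ) ∣ (ℓ + 1 : ℤ) - W'.LFunction ℓ)
    (hPR : ∀ {N D M p d : ℕ}, p.Prime → D = p * d → IsAdmissibleFactorization N D M →
      ∀ (X : ShimuraCurveData D M) (W : WeierstrassCurve ℚ) [W.IsElliptic], W.conductorNorm ℤ = N →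
      ∀ (W' : WeierstrassCurve ℚ) [W'.IsElliptic] (P : ShimuraParametrizationData X W'),
        P.IsMinimalFor W →
      ∀ (S : Brandt.XiSetup (p * M) d) (i j : ℕ), 0 < i →
        i * j = (W'.minimalDiscriminantNorm ℤ).factorization p →
        P.deg * i = S.xi (fun n => W'.LFunction n) * j →
        (p ≠ 2 → j ∣ p - 1) ∧ (p = 2 → j ∣ 2)) :
    PastenShimura2024_componentOrders :=
  componentOrders_of_selection hTlev hT2 hEis hPR
    (fun {D M} {_X} {W'} P p =>
      if p ∣ M then
        (if h : ∃ ij : ℕ × ℕ, 0 < ij.1 ∧ 0 < ij.2 ∧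
            ij.1 * ij.2 = (W'.minimalDiscriminantNorm ℤ).factorization p ∧
            P.deg * ij.1 = brandtXi (M / p) (D * p) (fun n => W'.LFunction n) * ij.2
          then Classical.choose h else (1, 1))
      else
        (if h : ∃ ij : ℕ × ℕ, 0 < ij.1 ∧ 0 < ij.2 ∧
            ij.1 * ij.2 = (W'.minimalDiscriminantNorm ℤ).factorization p ∧
            P.deg * ij.1 = brandtXi (p * M) (D / p) (fun n => W'.LFunction n) * ij.2
          then Classical.choose h else (1, 1)))
    (fun _ _ => rfl)

/-! ## IV. The fact over the two character-group dictionaries -/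

/-- **`PastenShimura2024_componentOrders` over the character-group dictionaries, the exact Eisenstein
property and Papikian–Rabinoff.** As `PastenShimura2024_componentOrders_of_takahashi_coordinates`, with
Takahashi's Thm. 2.3 on the level side (`hTlev`) and on the discriminant side (`hT2`) DERIVED
(`thm_2_3_level_of_brandtDictionary`, `thm_2_3_disc_of_brandtDictionary`, `…BrandtDictionaryProofs`)
from the dictionaries `hDict` (Takahashi §2 p. 78 and p. 84, Buzzard 1997 Thm. 4.7, SGA 7 IX 11.5,
multiplicity one: the data `X_p(J₀^D(M)) ≅ ℤ[Cls O]⁰`, `q^*`, `q_*` inside the Brandt module of type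
`(M/p, Dp)`) and `hDictDisc` (Prop. 3.1 p. 82, Ribet's exact sequence: the same inside the Brandt module
of type `(pM, D/p)`) — so that Takahashi's Lemma 2.2 / Thm. 2.3 on both sides and Ribet–Takahashi's
Thm. 2 are theorems, and the inputs are the two dictionaries, Ribet's exact Eisenstein divisibility
(`hEis`; the dictionary alone gives it only up to the factor `12`, `eisenstein12_of_brandtDictionary`)
and Papikian–Rabinoff (`hPR`).
[cite: Takahashi2001, §2 p. 78, Thm. 2.3 (p. 79), Prop. 3.1 and Thm. 3.2 (a) (p. 82), p. 84]
[cite: PastenShimura2024, §6.6 and Prop. 6.13 p. 23, Lemma 6.14 (proof) p. 23, Lemma 6.18 pp. 24–25]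
[cite: PapikianRabinoff2016, Cor. 3.5] -/
theorem PastenShimura2024_componentOrders_of_brandtDictionaries
    (hDict : ∀ {N D M p m : ℕ}, p.Prime → M = p * m → ¬ p ∣ m → IsAdmissibleFactorization N D M →
      ∀ (X : ShimuraCurveData D M) (W : WeierstrassCurve ℚ) [W.IsElliptic], W.conductorNorm ℤ = N →
      ∀ (W' : WeierstrassCurve ℚ) [W'.IsElliptic] (P : ShimuraParametrizationData X W'),
        P.IsMinimalFor W →
      ∀ (S : Brandt.XiSetup m (D * p)) [Fintype (Brandt.ClassSet S.O)],
        ∃ (Y : Submodule ℤ (Brandt.ClassSet S.O → ℤ)) (pb : ℤ →ₗ[ℤ] Y) (pf : Y →ₗ[ℤ] ℤ),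
          (∀ (a : ℤ) (y : Y),
              ∑ i, (Brandt.weight S.O i : ℤ) * (pb a : Brandt.ClassSet S.O → ℤ) i *
                  (y : Brandt.ClassSet S.O → ℤ) i =
                ((W'.minimalDiscriminantNorm ℤ).factorization p : ℤ) * a * pf y) ∧
          (∀ a : ℤ, pf (pb a) = (P.deg : ℤ) * a) ∧
          Function.Surjective pf ∧
          (∀ (k : ℤ) (v : Brandt.ClassSet S.O → ℤ), k ≠ 0 → k • v ∈ Y → v ∈ Y) ∧
          (∀ v : Brandt.ClassSet S.O → ℤ, ∑ i, v i = 0 → v ∈ Y) ∧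
          Module.finrank ℤ
              (Brandt.eigenLattice (m * (D * p)) (Brandt.matrix S.O) (fun n => W'.LFunction n)) = 1 ∧
          (pb 1 : Brandt.ClassSet S.O → ℤ) ∈
            Brandt.eigenLattice (m * (D * p)) (Brandt.matrix S.O) (fun n => W'.LFunction n))
    (hDictDisc : ∀ {N D M p d : ℕ}, p.Prime → D = p * d → IsAdmissibleFactorization N D M →
      ∀ (X : ShimuraCurveData D M) (W : WeierstrassCurve ℚ) [W.IsElliptic], W.conductorNorm ℤ = N →
      ∀ (W' : WeierstrassCurve ℚ) [W'.IsElliptic] (P : ShimuraParametrizationData X W'),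
        P.IsMinimalFor W →
      ∀ (S : Brandt.XiSetup (p * M) d) [Fintype (Brandt.ClassSet S.O)],
        ∃ (Y : Submodule ℤ (Brandt.ClassSet S.O → ℤ)) (pb : ℤ →ₗ[ℤ] Y) (pf : Y →ₗ[ℤ] ℤ),
          (∀ (a : ℤ) (y : Y),
              ∑ i, (Brandt.weight S.O i : ℤ) * (pb a : Brandt.ClassSet S.O → ℤ) i *
                  (y : Brandt.ClassSet S.O → ℤ) i =
                ((W'.minimalDiscriminantNorm ℤ).factorization p : ℤ) * a * pf y) ∧
          (∀ a : ℤ, pf (pb a) = (P.deg : ℤ) * a) ∧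
          Function.Surjective pf ∧
          (∀ (k : ℤ) (v : Brandt.ClassSet S.O → ℤ), k ≠ 0 → k • v ∈ Y → v ∈ Y) ∧
          Module.finrank ℤ
              (Brandt.eigenLattice (p * M * d) (Brandt.matrix S.O) (fun n => W'.LFunction n)) = 1 ∧
          (pb 1 : Brandt.ClassSet S.O → ℤ) ∈
            Brandt.eigenLattice (p * M * d) (Brandt.matrix S.O) (fun n => W'.LFunction n))
    (hEis : ∀ {N D M p m : ℕ}, p.Prime → M = p * m → ¬ p ∣ m → IsAdmissibleFactorization N D M →
      ∀ (X : ShimuraCurveData D M) (W : WeierstrassCurve ℚ) [W.IsElliptic], W.conductorNorm ℤ = N →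
      ∀ (W' : WeierstrassCurve ℚ) [W'.IsElliptic] (P : ShimuraParametrizationData X W'),
        P.IsMinimalFor W →
      ∀ (S : Brandt.XiSetup m (D * p)) (i j : ℕ), 0 < i →
        i * j = (W'.minimalDiscriminantNorm ℤ).factorization p →
        P.deg * i = S.xi (fun n => W'.LFunction n) * j →
        ∀ ℓ : ℕ, ℓ.Prime → ¬ ℓ ∣ N → (i : ℤ) ∣ (ℓ + 1 : ℤ) - W'.LFunction ℓ)
    (hPR : ∀ {N D M p d : ℕ}, p.Prime → D = p * d → IsAdmissibleFactorization N D M →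
      ∀ (X : ShimuraCurveData D M) (W : WeierstrassCurve ℚ) [W.IsElliptic], W.conductorNorm ℤ = N →
      ∀ (W' : WeierstrassCurve ℚ) [W'.IsElliptic] (P : ShimuraParametrizationData X W'),
        P.IsMinimalFor W →
      ∀ (S : Brandt.XiSetup (p * M) d) (i j : ℕ), 0 < i →
        i * j = (W'.minimalDiscriminantNorm ℤ).factorization p →
        P.deg * i = S.xi (fun n => W'.LFunction n) * j →
        (p ≠ 2 → j ∣ p - 1) ∧ (p = 2 → j ∣ 2)) :
    PastenShimura2024_componentOrders :=
  PastenShimura2024_componentOrders_of_takahashi_coordinates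
    (fun hp hM hpm hadm X W _ hWN W' _ P hP S =>
      thm_2_3_level_of_brandtDictionary hDict hp hM hpm hadm X W hWN W' P hP S)
    (fun hp hD hadm X W _ hWN W' _ P hP S =>
      thm_2_3_disc_of_brandtDictionary hDictDisc hp hD hadm X W hWN W' P hP S)
    hEis hPR


/-! ## V. Without Ribet's exact Eisenstein theorem: the `12`-version over the two dictionaries -/

/-- **The Eisenstein divisibility up to the factor `12` at the selected `i_p`**: if every solution of
the level system at `(P, p)`, `p ∥ M`, has `i ∣ 12 (ℓ + 1 − a_ℓ(W'))` (`hEis12` — which the level-side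
dictionary alone PROVIDES, `eisenstein12_of_brandtDictionary`: Eichler's weight symmetry and column sums
`ℓ + 1`, Gross 1987 §2 / Ribet 1990 Thm. 3.12) and `(cI, cJ)` solves that system (`hlev`), then
`cI P p ∣ 12 (ℓ + 1 − a_ℓ(W'))`. For primes `ℓ'` with `ℓ' ∤ 6` this has the same `ℓ'`-adic content as
Pasten's exact divisibility (Lemma 6.14, proof). [cite: PastenShimura2024, Lemma 6.14 p. 23 (proof)] [cite: Ribet1990, Thm. 3.12] -/
theorem imageEisenstein12_of_coordinates (cI cJ : ComponentOrderFun)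
    (hlev : ∀ {N D M p m : ℕ}, p.Prime → M = p * m → ¬ p ∣ m → IsAdmissibleFactorization N D M →
      ∀ (X : ShimuraCurveData D M) (W : WeierstrassCurve ℚ) [W.IsElliptic], W.conductorNorm ℤ = N →
      ∀ (W' : WeierstrassCurve ℚ) [W'.IsElliptic] (P : ShimuraParametrizationData X W'),
        P.IsMinimalFor W →
      ∀ S : Brandt.XiSetup m (D * p),
        0 < cI P p ∧ cI P p * cJ P p = (W'.minimalDiscriminantNorm ℤ).factorization p ∧
          P.deg * cI P p = S.xi (fun n => W'.LFunction n) * cJ P p)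
    (hEis12 : ∀ {N D M p m : ℕ}, p.Prime → M = p * m → ¬ p ∣ m → IsAdmissibleFactorization N D M →
      ∀ (X : ShimuraCurveData D M) (W : WeierstrassCurve ℚ) [W.IsElliptic], W.conductorNorm ℤ = N →
      ∀ (W' : WeierstrassCurve ℚ) [W'.IsElliptic] (P : ShimuraParametrizationData X W'),
        P.IsMinimalFor W →
      ∀ (S : Brandt.XiSetup m (D * p)) (i j : ℕ), 0 < i →
        i * j = (W'.minimalDiscriminantNorm ℤ).factorization p →
        P.deg * i = S.xi (fun n => W'.LFunction n) * j →
        ∀ ℓ : ℕ, ℓ.Prime → ¬ ℓ ∣ N → (i : ℤ) ∣ 12 * ((ℓ + 1 : ℤ) - W'.LFunction ℓ))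
    {N D M : ℕ} (hadm : IsAdmissibleFactorization N D M) (X : ShimuraCurveData D M)
    (W : WeierstrassCurve ℚ) [W.IsElliptic] (hWN : W.conductorNorm ℤ = N) (W' : WeierstrassCurve ℚ)
    [W'.IsElliptic] (P : ShimuraParametrizationData X W') (hP : P.IsMinimalFor W) (p : ℕ)
    (hp : p.Prime) (hpM : p ∣ M) (hp2 : ¬ p ^ 2 ∣ M) (r : ℕ) (hr : r.Prime) (hrN : ¬ r ∣ N) :
    (cI P p : ℤ) ∣ 12 * ((r + 1 : ℤ) - W'.LFunction r) := by
  obtain ⟨m, hM⟩ := hpM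
  have hpm : ¬ p ∣ m := fun h => hp2 (by rw [hM, sq]; exact Nat.mul_dvd_mul_left p h)
  obtain ⟨S⟩ := hadm.nonempty_xiSetup_level hp hM hpm
  obtain ⟨hI, hc, hδ⟩ := hlev hp hM hpm hadm X W hWN W' P hP S
  exact hEis12 hp hM hpm hadm X W hWN W' P hP S (cI P p) (cJ P p) hI hc hδ r hr hrN

open scoped Classical in
/-- **The component orders with the Eisenstein clause up to `12`, from the two character-group
dictionaries and Papikian–Rabinoff ALONE** (no Ribet/Edixhoven input). From `hDict` (level side,
type `(M/p, Dp)`), `hDictDisc` (discriminant side, type `(pM, D/p)`) and `hPR` there are positive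
Skolem functions `cI = i_p`, `cJ = j_p` with (Π) `ComponentOrders.ProductEq`, (6.13)
`ComponentOrders.Prop613`, (6.18) `ComponentOrders.CokernelDvd`, and the Eisenstein divisibility in the
form `i_p(D,M) ∣ 12 (r + 1 − a_r(A_{D,M}))` for `p ∥ M`, `r ∤ N` — the conjunction
`PastenShimura2024_componentOrders` with its third clause `ComponentOrders.ImageEisenstein` weakened by
the factor `12 = lcm` of the unit weights `w_c` of the Brandt module (the naive Eisenstein property of
`ℤ[Cls O]/(𝟙, w·ℤ[Cls O]⁰)`; exactness is Ribet's theorem, the input `hEis` of §III). At a prime `ℓ ∤ 6`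
the `ℓ`-adic content is that of the exact clause, so consumers working at `ℓ ≥ 5` (e.g. the class
`X11b` files of `Summits/BirchSwinnertonDyer` at `5 ≤ p`) can be re-keyed to this theorem with the trust
base {`hDict`, `hDictDisc`, `hPR`}. [cite: PastenShimura2024, §6.6 and Prop. 6.13 p. 23, Lemma 6.14 (proof) p. 23, Lemma 6.18 pp. 24–25]
[cite: Takahashi2001, §2 p. 78, Thm. 2.3 (p. 79), Prop. 3.1 and Thm. 3.2 (a) (p. 82), p. 84]
[cite: Ribet1990, Prop. 3.1 and Thm. 3.12] [cite: PapikianRabinoff2016, Cor. 3.5] -/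
theorem PastenShimura2024_componentOrders12_of_brandtDictionaries
    (hDict : ∀ {N D M p m : ℕ}, p.Prime → M = p * m → ¬ p ∣ m → IsAdmissibleFactorization N D M →
      ∀ (X : ShimuraCurveData D M) (W : WeierstrassCurve ℚ) [W.IsElliptic], W.conductorNorm ℤ = N →
      ∀ (W' : WeierstrassCurve ℚ) [W'.IsElliptic] (P : ShimuraParametrizationData X W'),
        P.IsMinimalFor W →
      ∀ (S : Brandt.XiSetup m (D * p)) [Fintype (Brandt.ClassSet S.O)],
        ∃ (Y : Submodule ℤ (Brandt.ClassSet S.O → ℤ)) (pb : ℤ →ₗ[ℤ] Y) (pf : Y →ₗ[ℤ] ℤ),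
          (∀ (a : ℤ) (y : Y),
              ∑ i, (Brandt.weight S.O i : ℤ) * (pb a : Brandt.ClassSet S.O → ℤ) i *
                  (y : Brandt.ClassSet S.O → ℤ) i =
                ((W'.minimalDiscriminantNorm ℤ).factorization p : ℤ) * a * pf y) ∧
          (∀ a : ℤ, pf (pb a) = (P.deg : ℤ) * a) ∧
          Function.Surjective pf ∧
          (∀ (k : ℤ) (v : Brandt.ClassSet S.O → ℤ), k ≠ 0 → k • v ∈ Y → v ∈ Y) ∧
          (∀ v : Brandt.ClassSet S.O → ℤ, ∑ i, v i = 0 → v ∈ Y) ∧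
          Module.finrank ℤ
              (Brandt.eigenLattice (m * (D * p)) (Brandt.matrix S.O) (fun n => W'.LFunction n)) = 1 ∧
          (pb 1 : Brandt.ClassSet S.O → ℤ) ∈
            Brandt.eigenLattice (m * (D * p)) (Brandt.matrix S.O) (fun n => W'.LFunction n))
    (hDictDisc : ∀ {N D M p d : ℕ}, p.Prime → D = p * d → IsAdmissibleFactorization N D M →
      ∀ (X : ShimuraCurveData D M) (W : WeierstrassCurve ℚ) [W.IsElliptic], W.conductorNorm ℤ = N →
      ∀ (W' : WeierstrassCurve ℚ) [W'.IsElliptic] (P : ShimuraParametrizationData X W'),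
        P.IsMinimalFor W →
      ∀ (S : Brandt.XiSetup (p * M) d) [Fintype (Brandt.ClassSet S.O)],
        ∃ (Y : Submodule ℤ (Brandt.ClassSet S.O → ℤ)) (pb : ℤ →ₗ[ℤ] Y) (pf : Y →ₗ[ℤ] ℤ),
          (∀ (a : ℤ) (y : Y),
              ∑ i, (Brandt.weight S.O i : ℤ) * (pb a : Brandt.ClassSet S.O → ℤ) i *
                  (y : Brandt.ClassSet S.O → ℤ) i =
                ((W'.minimalDiscriminantNorm ℤ).factorization p : ℤ) * a * pf y) ∧
          (∀ a : ℤ, pf (pb a) = (P.deg : ℤ) * a) ∧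
          Function.Surjective pf ∧
          (∀ (k : ℤ) (v : Brandt.ClassSet S.O → ℤ), k ≠ 0 → k • v ∈ Y → v ∈ Y) ∧
          Module.finrank ℤ
              (Brandt.eigenLattice (p * M * d) (Brandt.matrix S.O) (fun n => W'.LFunction n)) = 1 ∧
          (pb 1 : Brandt.ClassSet S.O → ℤ) ∈
            Brandt.eigenLattice (p * M * d) (Brandt.matrix S.O) (fun n => W'.LFunction n))
    (hPR : ∀ {N D M p d : ℕ}, p.Prime → D = p * d → IsAdmissibleFactorization N D M →
      ∀ (X : ShimuraCurveData D M) (W : WeierstrassCurve ℚ) [W.IsElliptic], W.conductorNorm ℤ = N →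
      ∀ (W' : WeierstrassCurve ℚ) [W'.IsElliptic] (P : ShimuraParametrizationData X W'),
        P.IsMinimalFor W →
      ∀ (S : Brandt.XiSetup (p * M) d) (i j : ℕ), 0 < i →
        i * j = (W'.minimalDiscriminantNorm ℤ).factorization p →
        P.deg * i = S.xi (fun n => W'.LFunction n) * j →
        (p ≠ 2 → j ∣ p - 1) ∧ (p = 2 → j ∣ 2)) :
    ∃ cI cJ : ComponentOrderFun,
      (∀ {D M : ℕ} {X : ShimuraCurveData D M} {W' : WeierstrassCurve ℚ}
          (P : ShimuraParametrizationData X W') (p : ℕ), 0 < cI P p ∧ 0 < cJ P p) ∧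
      ComponentOrders.ProductEq cI cJ ∧ ComponentOrders.Prop613 cI cJ ∧
      (∀ {N D M : ℕ}, IsAdmissibleFactorization N D M →
        ∀ (X : ShimuraCurveData D M) (W : WeierstrassCurve ℚ) [W.IsElliptic] [W.IsGloballyMinimal],
          W.conductorNorm ℤ = N →
        ∀ (W' : WeierstrassCurve ℚ) [W'.IsElliptic] (P : ShimuraParametrizationData X W'),
          P.IsMinimalFor W → ∀ p : ℕ, p.Prime → p ∣ M → ¬ p ^ 2 ∣ M →
          ∀ r : ℕ, r.Prime → ¬ r ∣ N → (cI P p : ℤ) ∣ 12 * ((r + 1 : ℤ) - W'.LFunction r)) ∧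
      ComponentOrders.CokernelDvd cJ := by
  -- Thm. 2.3 on both sides and the Eisenstein divisibility (factor `12`) from the dictionaries
  have hTlev := fun {N D M p m : ℕ} (hp : p.Prime) (hM : M = p * m) (hpm : ¬ p ∣ m)
      (hadm : IsAdmissibleFactorization N D M) (X : ShimuraCurveData D M) (W : WeierstrassCurve ℚ)
      [W.IsElliptic] (hWN : W.conductorNorm ℤ = N) (W' : WeierstrassCurve ℚ) [W'.IsElliptic]
      (P : ShimuraParametrizationData X W') (hP : P.IsMinimalFor W) (S : Brandt.XiSetup m (D * p)) =>
    thm_2_3_level_of_brandtDictionary hDict hp hM hpm hadm X W hWN W' P hP S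
  have hT2 := fun {N D M p d : ℕ} (hp : p.Prime) (hD : D = p * d)
      (hadm : IsAdmissibleFactorization N D M) (X : ShimuraCurveData D M) (W : WeierstrassCurve ℚ)
      [W.IsElliptic] (hWN : W.conductorNorm ℤ = N) (W' : WeierstrassCurve ℚ) [W'.IsElliptic]
      (P : ShimuraParametrizationData X W') (hP : P.IsMinimalFor W) (S : Brandt.XiSetup (p * M) d) =>
    thm_2_3_disc_of_brandtDictionary hDictDisc hp hD hadm X W hWN W' P hP S
  -- the coupled selection
  let sel : ∀ {D M : ℕ} {X : ShimuraCurveData D M} {W' : WeierstrassCurve ℚ},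
      ShimuraParametrizationData X W' → ℕ → ℕ × ℕ := fun {D M} {_X} {W'} P p =>
    if p ∣ M then
      (if h : ∃ ij : ℕ × ℕ, 0 < ij.1 ∧ 0 < ij.2 ∧
          ij.1 * ij.2 = (W'.minimalDiscriminantNorm ℤ).factorization p ∧
          P.deg * ij.1 = brandtXi (M / p) (D * p) (fun n => W'.LFunction n) * ij.2
        then Classical.choose h else (1, 1))
    else
      (if h : ∃ ij : ℕ × ℕ, 0 < ij.1 ∧ 0 < ij.2 ∧
          ij.1 * ij.2 = (W'.minimalDiscriminantNorm ℤ).factorization p ∧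
          P.deg * ij.1 = brandtXi (p * M) (D / p) (fun n => W'.LFunction n) * ij.2
        then Classical.choose h else (1, 1))
  have hsel : ∀ {D M : ℕ} {X : ShimuraCurveData D M} {W' : WeierstrassCurve ℚ}
      (P : ShimuraParametrizationData X W') (p : ℕ),
      sel P p =
        if p ∣ M then
          (if h : ∃ ij : ℕ × ℕ, 0 < ij.1 ∧ 0 < ij.2 ∧
              ij.1 * ij.2 = (W'.minimalDiscriminantNorm ℤ).factorization p ∧
              P.deg * ij.1 = brandtXi (M / p) (D * p) (fun n => W'.LFunction n) * ij.2
            then Classical.choose h else (1, 1))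
        else
          (if h : ∃ ij : ℕ × ℕ, 0 < ij.1 ∧ 0 < ij.2 ∧
              ij.1 * ij.2 = (W'.minimalDiscriminantNorm ℤ).factorization p ∧
              P.deg * ij.1 = brandtXi (p * M) (D / p) (fun n => W'.LFunction n) * ij.2
            then Classical.choose h else (1, 1)) := fun _ _ => rfl
  have hlev := @selection_level hTlev sel hsel
  have hdisc := @selection_disc hT2 sel hsel
  refine ⟨fun P p => (sel P p).1, fun P p => (sel P p).2, selection_pos sel hsel,
    productEq_of_coordinates _ _ hlev hdisc, prop613_of_coordinates _ _ hlev hdisc, ?_,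
    cokernelDvd_of_coordinates hPR _ _ hdisc⟩
  intro N D M hadm X W _ _ hWN W' _ P hP p hp hpM hp2 r hr hrN
  exact imageEisenstein12_of_coordinates _ _ hlev
    (fun hp hM hpm hadm X W _ hWN W' _ P hP S i j hi hij hδ ℓ hℓ hℓN =>
      eisenstein12_of_brandtDictionary hDict hp hM hpm hadm X W hWN W' P hP S i j hi hij hδ ℓ hℓ hℓN)
    hadm X W hWN W' P hP p hp hpM hp2 r hr hrN

end Literature.NumberTheory.Automorphic

end
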